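import Summits.BirchSwinnertonDyer.BirchSwinnertonDyer.Theorems.ErratumRoadFiveNonSurjCornerHybridTwinLowerSupply
import Summits.BirchSwinnertonDyer.BirchSwinnertonDyer.Theorems.PrintX11aLowerHalfNonSurjDoors
import HarnessLib

/-!
# Route `ErratumRoadFive` (rung K2), crux `NonSurjCorner` (item stmt-BirchSwinnertonDyer-19065), registered line `Lines/hybrid.lean`:
# GLUE #9 — SLOT 4 DERIVED: the X11a lower half at the corner's non-surjective LEAF TWINS follows from SLOT 2 (item 19948, analytic μ = 0 at
# the SAME twins) and NAMED facts, by x11a's non-surjective Hida-family chain (bsd-line-er5-p2, p609759); the line keeps SIX open-or-citable stubs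
# (cell `bsd-stepL`, seat `bsd-stepL-corner-p1` g16; `--supports stmt-BirchSwinnertonDyer-19065 --as helper`)

WHY THIS FILE. Glue #8 (this seat g16, `…HybridTwinLowerSupply`) narrowed slot 4 of the hybrid line to `h₄ℓ` — the main-conjecture (lower) half
`MissingLowerBoundAt Wd p` ONLY at the corner's rank-0 NON-SURJECTIVE LEAF TWINS (`ClassX11a Wd p`, `¬ Surj Wd p`, `p ∈ {5,7}`,
`p ∣ ord_p Δ_min(Wd)`, non-unit `#Ш_an`), which is EXACTLY the population on which slot 2 (`stub_twinMuAn57` = item 19948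
`NonSurjCornerTwinMuAn`) asks analytic `μ = 0`. The same hour, the width seat bsd-line-er5-p2 of 19064's line landed
`NonSurjChain.lowerNonSurj_fiveSeven_of_nonSurjCornerTwinMuAn_of_facts` (`Theorems/PrintX11aLowerHalfNonSurjDoors.lean`, p609759): at every
NON-surjective X11a pair with `p ∈ {5,7}`, `Theorems.NonSurjCornerTwinMuAn` (19948's body) + SEVENTEEN named facts ⟹ `MissingLowerBoundAt` —
`μ^an = 0` ⟹ (Kato, no big image: `μ^alg = 0`) ⟹ EPW's Hida-family transfer to a weight-`k` member with IRREDUCIBLE residual representation ⟹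
Wan 2015 Thm 4 (rational main conjecture, (irred)) ⟹ Mazur's main conjecture at the pair ⟹ BSDp ⟹ the lower half. Eleven of the seventeen
facts are conjuncts of item 19949 `KatoTwinFactsFiveAn` (slot 3); the other SIX are EPW 2006 Thm 3.1.1 ∕ Thm 1 ∕ Thm 5.1.3 (members of level),
Wan 2015 Thm 4 (irred), Deligne–Serre 6.1, Hida 2000 Thm 3.26. So slot 4 is DERIVED:
* **glue #9 `nonSurjCorner_of_kolyZShaAn_of_twinMuAn_of_katoFacts_of_hidaFacts_of_sixNamedInputs_of_savedDisplay_of_threeBadSplit`** — glue #8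
  with `h₄ℓ` := er5-p2's theorem ∘ (19948, eleven conjuncts of 19949, the six Hida-side facts `hHida`). Binders: `hZan` (structured Kolyvagin
  stub, population 0 on the census), 19948, 19949, `hHida` (CITABLE), hMax (3 names), hShim6 (6 names), `hSav` (lane B's OPEN saved display),
  `hres3bad` (structural residual). Candidate composition of `Lines/hybrid.lean` r7 (slot 4 ↦ `stub_hidaTwinFacts57`, CITABLE).
EFFECT on the line: rung K6's object (`X11aLowerHalf`, any sub-leaf of it) LEAVES 19065's cone altogether; the corner's ONLY non-citable input
at the rank-0 twins is item 19948 (analytic `μ = 0`, per pair a finite modular-symbol certificate — lane B corner5-p2's census). Remaining open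
stubs: `stub_kolyZShaAnDeep57` (census population 0), 19948, `stub_savedDisplay57` (lane B corner3-p2 g9 is writing the p-generic image-keyed
port targets, 06:49Z), `stub_threeSplit57` (population 0); citable: 19949, hMax ∕ hShim6, `hHida`.

HONEST FRAMING: ONE THEOREM (no definition, no named fact, no `sorry`); CONDITIONAL on every displayed binder — among the named facts, three
Kato §17.13 construction facts of 19949 are flagged STRONGER-THAN-PRINT-BY-ι (ARM-P R-48; re-key to the print-exact contragredient twins p604443
via `exists_twist_selmerDualData_invol` p609264 is this seat's next task) and Wan 2015 Thm 4 carries its typer's flag; item 19065 is NOT closed;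
no stub is discharged; nothing about any curve's BSD; BSD is not advanced; T7. Credit: bsd-line-er5-p2 (the non-surjective Hida chain and its
doors), x11a lane (EPW ∕ Wan ∕ Hida typings, `X11a.Chain`), lane B corner3-p2 g6 (supply), planner g39 (RULING 48).
References (locators only): [cite: EmertonPollackWeston2006, Thm. 3.1.1, Thm. 1, Thm. 5.1.3] [cite: Wan2015, Thm. 4] [cite: GreenbergLNM1716, Conj. 1.11]
[cite: Kato2004Asterisque, Thm. 12.4 and §17.13] [cite: Miller2011LMS, Def. 1.1] [cite: SilvermanATAEC1994, V.6 Prop. 6.1].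
-/

set_option autoImplicit false
set_option linter.dupNamespace false -- `Summit.BirchSwinnertonDyer.BirchSwinnertonDyer` (summit = problem), tree-wide

noncomputable section

open scoped Classical NumberField MatrixGroups ModularForm

namespace Summit.BirchSwinnertonDyer.BirchSwinnertonDyer.Theorems

open CongruenceSubgroup WeierstrassCurve NumberField IsDedekindDomain Field Rat.HeightOneSpectrum
  Literature.NumberTheory.EllipticCurves
  Literature.NumberTheory.EllipticCurves.ModularForms
  Literature.NumberTheory.EllipticCurves.Rank1Residual
  Literature.NumberTheory.EllipticCurves.Rank1Residual.Typed
  Literature.NumberTheory.EllipticCurves.Wuthrich2014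
  Literature.NumberTheory.EllipticCurves.SteinWuthrich2013
  Literature.NumberTheory.EllipticCurves.Greenberg1999
  Literature.NumberTheory.EllipticCurves.Kato2004
  Literature.NumberTheory.EllipticCurves.BarriosEtAl2025
  Literature.NumberTheory.EllipticCurves.EmertonPollackWeston2006
  Literature.NumberTheory.GaloisRepresentations Literature.NumberTheory.GaloisCohomology
  Literature.NumberTheory.Automorphic
  Summit.BirchSwinnertonDyer.Rank1Residual
  Summit.BirchSwinnertonDyer.Rank1Residual.X11b
  Summit.BirchSwinnertonDyer.Rank1Residual.X11b.Three.Koly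

/-- **THE HYBRID GLUE (glue #9) — SLOT 4 DERIVED FROM SLOT 2 AND NAMED FACTS.** As glue #8 (`…HybridTwinLowerSupply` §2) with its slot-4 binder
`h₄ℓ` (the lower half at the corner's non-surjective LEAF twins with non-unit `#Ш_an`) SUPPLIED by bsd-line-er5-p2's
`NonSurjChain.lowerNonSurj_fiveSeven_of_nonSurjCornerTwinMuAn_of_facts` from `hμ` (item 19948: analytic `μ = 0` at the same twins), eleven
conjuncts of `hF` (item 19949) and the six Hida-side named facts `hHida` (EPW 2006 Thm 3.1.1 ∕ Thm 1 ∕ Thm 5.1.3, Wan 2015 Thm 4 (irred),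
Deligne–Serre 6.1, Hida 3.26). Binders: `hZan` → 19948 → 19949 → `hHida` → hMax → hShim6 → `hSav` → `hres3bad` → `NonSurjCorner`. CONDITIONAL
on every binder; 19065 NOT closed; nothing booked; T7. [cite: EmertonPollackWeston2006, Thm. 5.1.3] [cite: Wan2015, Thm. 4]
[cite: Kato2004Asterisque, Thm. 12.4] [cite: Miller2011LMS, Def. 1.1] [cite: Cha2005, Thm. 21 and Rmk. 25] [cite: JetchevSkinnerWan2017, §7.4.2] -/
theorem nonSurjCorner_of_kolyZShaAn_of_twinMuAn_of_katoFacts_of_hidaFacts_of_sixNamedInputs_of_savedDisplay_of_threeBadSplit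
    (hZan : ∀ (W : WeierstrassCurve ℚ) [W.IsElliptic] [W.IsGloballyMinimal] (p : ℕ) [Fact p.Prime]
      (N : ℕ) [NeZero N] (K : Type) [Field K] [NumberField K]
      (Dt : ModularParametrizationData W N) (β : ℤ) (ι : K →+* ℂ),
      ClassX11b W p → ¬ Surj W p → (p = 5 ∨ p = 7) → p ∣ padicValInt p W.minimalDiscriminantInt →
      ¬ Ram W p → (∃ s : ℚ, shaAn W = (s : ℂ) ∧ 0 < padicValRat p s) →
      W.conductorNorm ℤ = N → IsImaginaryQuadratic K →
      4 < (NumberField.discr K).natAbs → SatisfiesHeegnerHypothesis N K →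
      SatisfiesHeegnerHypothesis p K → (4 * (N : ℤ)) ∣ β ^ 2 - NumberField.discr K → ¬ (p : ℤ) ∣ Dt.c →
      (∃ (d₁ : KolyvaginHeegnerData Dt β ι 1) (y : (W.baseChange K).toAffine.Point),
        WeierstrassCurve.Affine.Point.map (W' := W) (algebraMap K (ringClassField K ι 1)).toRatAlgHom y =
          d₁.derivedPoint ∧
        ∃ Q : (W.baseChange K).toAffine.Point, ((p ^ (padicValNat p W.tamagawaProduct + 1) : ℕ) : ℤ) • Q = y) →
      ∃ M : ℕ, M ≤ padicValNat p W.tamagawaProduct ∧ CertificateAt Dt β ι p M)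
    (hμ : NonSurjCornerTwinMuAn)
    (hF : Summit.BirchSwinnertonDyer.BirchSwinnertonDyer.Theses.ErratumRoadFive.KatoTwinFactsFiveAn)
    -- slot 4 of r7: the six Hida-side NAMED facts of x11a's non-surjective chain (EPW 2006 ×3, Wan 2015 Thm 4 (irred), Deligne–Serre, Hida)
    (hHida : EmertonPollackWeston2006.thm311_cotorsion_weightK_member_ofLevel ∧
      EmertonPollackWeston2006.thm1_muAlg_of_weightK_member_ofLevel ∧
      Wan2015.thm4_rational_weightK_member_of_bdd_ofLevel_irred ∧
      EmertonPollackWeston2006.thm513_transfer_from_weightK_member_of_bdd_ofLevel ∧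
      DeligneSerre1974.thm61_exists_adicGaloisRep ∧ Hida2000_thm326_ordinary)
    (hMax : GrossLMS1991.prop37_2_frobeniusCongruence ∧
      (∀ (K : Type) [Field K] [NumberField K], poitouTate_selmerStructure_duality_conj K) ∧
      Gross1991_heegnerPoint_sub_ratTorsion_mem_E0_imageFree)
    (hShim6 : friedbergHoffstein_exists_twist_ne_zero_inertAt ∧ nonempty_shimuraParametrizationData ∧
      PastenShimura2024_componentOrders ∧
      (∀ (K : Type) [Field K] [NumberField K], casselsTate_levelInputs K) ∧
      shimuraCurve_heegnerSystem_primitivesFromFiveIrr ∧ shimuraCurve_heegnerSystem_primitivesSplitReduced)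
    (hSav : ∀ (W : WeierstrassCurve ℚ) [W.IsElliptic] [W.IsGloballyMinimal] (p : ℕ) [Fact p.Prime],
      ClassX11b W p → ¬ Surj W p → (p = 5 ∨ p = 7) → ∀ (q₁ : ℕ) [Fact q₁.Prime], ShimuraInertSavedDisplayAt W p q₁)
    (hres3bad : ∀ (W : WeierstrassCurve ℚ) [W.IsElliptic] [W.IsGloballyMinimal] (p : ℕ) [Fact p.Prime],
      ClassX11b W p → ¬ Surj W p → (p = 5 ∨ p = 7) → p ∣ padicValInt p W.minimalDiscriminantInt → ¬ Ram W p →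
      ∀ (q₁ q₂ q₃ : ℕ) [Fact q₁.Prime] [Fact q₂.Prime] [Fact q₃.Prime], q₁ ≠ p → q₂ ≠ p → q₃ ≠ p →
      q₁ ≠ q₂ → q₁ ≠ q₃ → q₂ ≠ q₃ →
      W.HasSplitMultiplicativeReductionAtPrime q₁ → W.HasSplitMultiplicativeReductionAtPrime q₂ →
      W.HasSplitMultiplicativeReductionAtPrime q₃ →
      (q₁ = 2 ∨ p ∣ q₁ - 1) → (q₂ = 2 ∨ p ∣ q₂ - 1) → (q₃ = 2 ∨ p ∣ q₃ - 1) → Typed.MissingUpperBoundAt W p) :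
    Summit.BirchSwinnertonDyer.BirchSwinnertonDyer.Theses.ErratumRoadFive.NonSurjCorner := by
  obtain ⟨-, -, -, hGZK, -, hnf, -, -, -, -, -, hJs, hJn, hGS, -, -, -, h12, hns, hsp, h15, h18, hfine⟩ := id hF
  obtain ⟨h311, hT1a, hT2, hT1b, h61, h326⟩ := hHida
  exact nonSurjCorner_of_kolyZShaAn_of_twinMuAn_of_katoFacts_of_lowerLeafTwinDeep_of_sixNamedInputs_of_savedDisplay_of_threeBadSplit hZan
    hμ hF
    (fun Wd _ _ p _ hXa hnsd h57 _ _ ↦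
      NonSurjChain.lowerNonSurj_fiveSeven_of_nonSurjCornerTwinMuAn_of_facts hnf h311 hT1a hT2 hT1b h61 h326 h12 hns hsp h15 h18
        hfine hJs hJn hGZK hGS hμ Wd p hXa hnsd h57)
    hMax hShim6 hSav hres3bad

end Summit.BirchSwinnertonDyer.BirchSwinnertonDyer.Theorems

end
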